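import Literature.NumberTheory.ModularSymbols.FullLevelHomologyParabolicPowers
import Literature.NumberTheory.ModularSymbols.FullLevelHomologyTranslateFamily
import Literature.NumberTheory.ModularSymbols.FullLevelHomologyTransferMaps
import Literature.NumberTheory.ModularSymbols.CuspidalClassMapKernel
import HarnessLib

/-!
# The spread period map kills the kernel of the up/down dictionary (granted Knapp's presentation):
# `TwistedSpreadKernelHyp` and the Eisenstein half of `SpreadKernelHyp` as theorems

Topic `Literature/NumberTheory/ModularSymbols`; namespace `Literature.NumberTheory.ModularSymbols.FullLevel`; sequel of
`FullLevelHomologyTranslateFamily` (`Π_f(Y)(g)` on weighted base classes as a transferred sum), `FullLevelHomologyTransferMaps`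
(the hypotheses `SpreadKernelHyp`, `TwistedSpreadKernelHyp`) and `CuspidalClassMapKernel` (kernel of `H₁(Γ₀(N)) → H(N)` =
parabolic/elliptic span, granted Knapp).  Proved theorems; no new named fact, no `sorry`, no instance, no notation.  Results
depending on Knapp's presentation take it as the explicit hypothesis `(H : periodFunctional_ker_le_ellipticParabolic_sup_commutator)`.

TELESCOPING.  For `γ̃ ∈ Γ_T`, `g ∈ GL₂(ℤ/p)` and an invariant weight `c`, the dictionary image of `e_{T̃}(g·[γ̃ ⊗ Σ c(t)δ_t])` is
`Σ_t c(t)·ψ(E_t)` with `ψ = {∞, (δ⁻¹ · δ)∞}` on `Γ_T` (additive) and `E_t = s(y_t)⁻¹ γ̃ s(y_{rt})`, `r = γ̄⁻¹ ∈ T̃`,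
`y_t = (tg⁻¹)T̃`.  Along the `r`-orbits the `E`'s multiply to `s(y_t)⁻¹ γ̃ⁿ s(y_t)` (`n = |T̃|`, `rⁿ = 1`), so
`n · Σ_t c(t)ψ(E_t) = Σ_t c(t)·ψ(s(y_t)⁻¹ γ̃ⁿ s(y_t))` (`card_smul_sum_eq_sum_pow`); this vanishes when `δ⁻¹γ̃δ` is PARABOLIC
(powers and conjugates of parabolics are parabolic — `FullLevelHomologyParabolicPowers`; parabolic
symbols vanish), while for ELLIPTIC `δ⁻¹γ̃δ` the class `cosetClass[γ̃ ⊗ aδ_{T̃}]` is `12`-torsion (`γ̃¹² = 1`), hence `0`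
for `12 ∈ kˣ`.  With `CuspidalClassMapKernel` (kernel spanned by such classes):

* **`spreadPeriod_eq_zero_of_cuspidal_eq_zero`** (`H`, `12 ∈ kˣ`): `z ∈ H₁(…)^{T̃}`, `dictionary z = 0 ⇒ Π_f z = 0`;
* **`twistedSpreadKernelHyp_of_knapp`** (`H`, `12 ∈ kˣ`): `TwistedSpreadKernelHyp k p M hpM f θ` holds for every `θ`;
* **`spreadKernelHyp_of_knapp_of_multOne`**: `SpreadKernelHyp` follows from `H` and the MULTIPLICITY-ONE hypothesis
  `MultOneHyp f` («an invariant class whose `f`-period class vanishes differs from a dictionary-kernel class by a class whose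
  every torus translate has zero `f`-period class» — stated here in the minimal operator-free form the proof needs).

Consumer: route BSD/TeichmullerTwistDescent, crux `TwistedPeriodLatticeSaturation` (hypotheses (H1)/(H2) of
`Summit.…TeichmullerTwistDescent.CarrierDatum.not_caseOne_of_carrier`).  Nothing about any elliptic curve is asserted.

## References
* A. W. Knapp, *Elliptic Curves* (1993), Prop. 11.22, (11.36)–(11.37). [Knapp1993]
* K. S. Brown, *Cohomology of Groups* (1982), Ch. III §9 (A)–(B) (transfer). [Brown1982]
* A. Ash, G. Stevens, Duke Math. J. 53 (1986), §1 (1.2)–(1.4). [AshStevens1986]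
* G. Shimura, *Introduction to the arithmetic theory of automorphic functions* (1971), §1.3 (parabolic/elliptic elements). [Shimura1971]
-/

noncomputable section

namespace Literature.NumberTheory.ModularSymbols

namespace FullLevel

open scoped MatrixGroups TensorProduct
open CategoryTheory CongruenceSubgroup groupHomology Finsupp Matrix
open Literature.Algebra.Homology
open Literature.NumberTheory.EllipticCurves.ModularForms

/-! ### Telescoping along torus orbits -/

section Telescope

variable (k : Type) [CommRing k] (p M : ℕ) [Fact p.Prime] (hpM : Nat.Coprime p M) [NeZero M] [NeZero (p ^ 2 * M)]
  [Fintype (diagTorus (ZMod p))]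
  (s : GL (Fin 2) (ZMod p) ⧸ diagTorus (ZMod p) → Gamma0 M) (hs : ∀ y, redGL p M (s y) • baseCoset p = y)

omit [NeZero M] [Fintype (diagTorus (ZMod p))] in
/-- `ψ(x) := {∞, (δ⁻¹xδ)∞} ⊗ 1 ∈ H(p²M; k)` for `x ∈ Γ_T` is additive: `ψ(xy) = ψ x + ψ y`. [cite: Knapp1993, Prop. 11.22] -/
theorem symbol_torusLevelEquiv_mul (x y : torusLevel p M) :
    Literature.NumberTheory.ModularSymbols.symbol (p ^ 2 * M) k (torusLevelEquiv p M hpM (x * y) : Gamma0 (p ^ 2 * M)) =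
      Literature.NumberTheory.ModularSymbols.symbol (p ^ 2 * M) k (torusLevelEquiv p M hpM x : Gamma0 (p ^ 2 * M)) +
        Literature.NumberTheory.ModularSymbols.symbol (p ^ 2 * M) k (torusLevelEquiv p M hpM y : Gamma0 (p ^ 2 * M)) := by
  rw [map_mul, Literature.NumberTheory.ModularSymbols.symbol_mul]

/-- The orbit products `P_j(t) := E(t) E(rt) ⋯ E(r^{j−1}t)` of the transfer elements of the translated family. [cite: Brown1982, Ch. III §9 (A)] -/
def orbitProd (γ : torusLevel p M) (g : GL (Fin 2) (ZMod p)) (t : diagTorus (ZMod p)) : ℕ → torusLevel p M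
  | 0 => 1
  | j + 1 => orbitProd γ g t j *
      transferFamily p M s hs (fun _ : diagTorus (ZMod p) => γ.1) (translateCoset p g) (redInv p M γ ^ j * t)

omit [NeZero M] [NeZero (p ^ 2 * M)] [Fintype (diagTorus (ZMod p))] in
/-- `P_j(t) = s(y_t)⁻¹ γ̃ʲ s(y_{rʲt})` in `Γ₀(M)`. [cite: Brown1982, Ch. III §9 (A)] -/
theorem coe_orbitProd (γ : torusLevel p M) (g : GL (Fin 2) (ZMod p)) (t : diagTorus (ZMod p)) (j : ℕ) :
    (orbitProd p M s hs γ g t j : Gamma0 M) =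
      (s (translateCoset p g t))⁻¹ * γ.1 ^ j * s (translateCoset p g (redInv p M γ ^ j * t)) := by
  induction j with
  | zero => simp [orbitProd]
  | succ j ih =>
    rw [orbitProd, Subgroup.coe_mul, ih, coe_transferFamily_translate, ← mul_assoc (redInv p M γ), ← pow_succ', pow_succ]
    group

omit [NeZero M] [Fintype (diagTorus (ZMod p))] in
/-- `ψ(P_j(t)) = Σ_{i<j} ψ(E(rⁱt))`. [cite: Brown1982, Ch. III §9 (A)] -/
theorem symbol_orbitProd (γ : torusLevel p M) (g : GL (Fin 2) (ZMod p)) (t : diagTorus (ZMod p)) (j : ℕ) :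
    Literature.NumberTheory.ModularSymbols.symbol (p ^ 2 * M) k (torusLevelEquiv p M hpM (orbitProd p M s hs γ g t j) : Gamma0 (p ^ 2 * M)) =
      ∑ i ∈ Finset.range j, Literature.NumberTheory.ModularSymbols.symbol (p ^ 2 * M) k
        (torusLevelEquiv p M hpM (transferFamily p M s hs (fun _ : diagTorus (ZMod p) => γ.1) (translateCoset p g)
          (redInv p M γ ^ i * t)) : Gamma0 (p ^ 2 * M)) := by
  induction j with
  | zero => rw [orbitProd, map_one, Finset.range_zero, Finset.sum_empty]; exact Literature.NumberTheory.ModularSymbols.symbol_one _ _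
  | succ j ih => rw [orbitProd, symbol_torusLevelEquiv_mul, ih, Finset.sum_range_succ]

omit [NeZero M] in
/-- **Telescoping**: `|T̃| · Σ_t c(t)ψ(E_t) = Σ_t c(t)·ψ(s(y_t)⁻¹ γ̃ⁿ s(y_t))` with `n = |T̃|` (invariant weight `c`).
[cite: Brown1982, Ch. III §9 (A)–(B)] -/
theorem card_smul_sum_eq_sum_orbitProd (γ : torusLevel p M) (g : GL (Fin 2) (ZMod p)) (c : diagTorus (ZMod p) → k)
    (hc : ∀ t, c (redInv p M γ * t) = c t) :
    (Fintype.card (diagTorus (ZMod p)) : k) • ∑ t : diagTorus (ZMod p), c t •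
        Literature.NumberTheory.ModularSymbols.symbol (p ^ 2 * M) k
          (torusLevelEquiv p M hpM (transferFamily p M s hs (fun _ : diagTorus (ZMod p) => γ.1) (translateCoset p g) t) :
            Gamma0 (p ^ 2 * M)) =
      ∑ t : diagTorus (ZMod p), c t • Literature.NumberTheory.ModularSymbols.symbol (p ^ 2 * M) k
        (torusLevelEquiv p M hpM (orbitProd p M s hs γ g t (Fintype.card (diagTorus (ZMod p)))) : Gamma0 (p ^ 2 * M)) := by
  have hci : ∀ (i : ℕ) (t : diagTorus (ZMod p)), c (redInv p M γ ^ i * t) = c t := by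
    intro i
    induction i with
    | zero => intro t; rw [pow_zero, one_mul]
    | succ i ih => intro t; rw [pow_succ', mul_assoc, hc, ih]
  -- each shifted sum equals the unshifted one
  have hshift : ∀ i : ℕ, ∑ t : diagTorus (ZMod p), c t • Literature.NumberTheory.ModularSymbols.symbol (p ^ 2 * M) k
      (torusLevelEquiv p M hpM (transferFamily p M s hs (fun _ : diagTorus (ZMod p) => γ.1) (translateCoset p g)
        (redInv p M γ ^ i * t)) : Gamma0 (p ^ 2 * M)) =
      ∑ t : diagTorus (ZMod p), c t • Literature.NumberTheory.ModularSymbols.symbol (p ^ 2 * M) k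
        (torusLevelEquiv p M hpM (transferFamily p M s hs (fun _ : diagTorus (ZMod p) => γ.1) (translateCoset p g) t) :
          Gamma0 (p ^ 2 * M)) := fun i =>
    Fintype.sum_equiv (Equiv.mulLeft (redInv p M γ ^ i)) _ _ fun t => by rw [Equiv.coe_mulLeft, hci]
  symm
  rw [Finset.sum_congr rfl (fun t _ => by rw [symbol_orbitProd, Finset.smul_sum]), Finset.sum_comm,
    Finset.sum_congr rfl (fun i _ => hshift i), Finset.sum_const, Finset.card_range, ← Nat.cast_smul_eq_nsmul k]

omit [NeZero M] [NeZero (p ^ 2 * M)] in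
/-- The orbit product over a full period: `P_n(t) = s(y_t)⁻¹ γ̃ⁿ s(y_t)` for `n = |T̃|` (`rⁿ = 1`). [cite: Brown1982, Ch. III §9 (A)] -/
theorem coe_orbitProd_card (γ : torusLevel p M) (g : GL (Fin 2) (ZMod p)) (t : diagTorus (ZMod p)) :
    (orbitProd p M s hs γ g t (Fintype.card (diagTorus (ZMod p))) : Gamma0 M) =
      (s (translateCoset p g t))⁻¹ * γ.1 ^ Fintype.card (diagTorus (ZMod p)) * s (translateCoset p g t) := by
  rw [coe_orbitProd, pow_card_eq_one, one_mul]

variable [Invertible (Fintype.card (diagTorus (ZMod p)) : k)]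

omit [NeZero M] in
/-- **The translated sums vanish under the power hypothesis**: if `ψ` kills every `x ∈ Γ_T` of the form `s₀⁻¹ γ̃ⁿ s₀`
(`n = |T̃|`), then `Σ_t c(t)ψ(E_t) = 0` for every `g` and every invariant weight. [cite: Brown1982, Ch. III §9 (A)–(B)] -/
theorem sum_symbol_transferFamily_eq_zero (γ : torusLevel p M)
    (hpow : ∀ (x : torusLevel p M) (s₀ : Gamma0 M),
      (x : Gamma0 M) = s₀⁻¹ * γ.1 ^ Fintype.card (diagTorus (ZMod p)) * s₀ →
        Literature.NumberTheory.ModularSymbols.symbol (p ^ 2 * M) k (torusLevelEquiv p M hpM x : Gamma0 (p ^ 2 * M)) = 0)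
    (g : GL (Fin 2) (ZMod p)) (c : diagTorus (ZMod p) → k) (hc : ∀ t, c (redInv p M γ * t) = c t) :
    ∑ t : diagTorus (ZMod p), c t • Literature.NumberTheory.ModularSymbols.symbol (p ^ 2 * M) k
      (torusLevelEquiv p M hpM (transferFamily p M s hs (fun _ : diagTorus (ZMod p) => γ.1) (translateCoset p g) t) :
        Gamma0 (p ^ 2 * M)) = 0 := by
  have h := card_smul_sum_eq_sum_orbitProd k p M hpM s hs γ g c hc
  have hR : ∑ t : diagTorus (ZMod p), c t • Literature.NumberTheory.ModularSymbols.symbol (p ^ 2 * M) k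
      (torusLevelEquiv p M hpM (orbitProd p M s hs γ g t (Fintype.card (diagTorus (ZMod p)))) : Gamma0 (p ^ 2 * M)) = 0 :=
    Finset.sum_eq_zero fun t _ => by rw [hpow _ _ (coe_orbitProd_card p M s hs γ g t), smul_zero]
  rw [hR] at h
  have h2 := congrArg (fun v => ⅟(Fintype.card (diagTorus (ZMod p)) : k) • v) h
  simp only [smul_smul, invOf_mul_self, one_smul, smul_zero] at h2
  exact h2

/-- **`Π_f` kills the weighted base classes of `γ̃` under the power hypothesis** (any weight). [cite: AshStevens1986, §1 (1.3)] -/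
theorem spreadPeriod_weightedBaseClass_eq_zero (f : CuspForm (Gamma0 (p ^ 2 * M)) 2) (γ : torusLevel p M)
    (hpow : ∀ (x : torusLevel p M) (s₀ : Gamma0 M),
      (x : Gamma0 M) = s₀⁻¹ * γ.1 ^ Fintype.card (diagTorus (ZMod p)) * s₀ →
        Literature.NumberTheory.ModularSymbols.symbol (p ^ 2 * M) k (torusLevelEquiv p M hpM x : Gamma0 (p ^ 2 * M)) = 0)
    (c : diagTorus (ZMod p) → k) (hc : ∀ t, c (redInv p M γ * t) = c t) :
    spreadPeriod k p M hpM f (weightedBaseClass k p M γ c hc) = 0 := by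
  funext g
  rw [spreadPeriod, PermutationCoeff.spread_apply, Pi.zero_apply, torusPeriodClass, LinearMap.comp_apply]
  erw [torusInvariantsToCuspidal_toInvariants_translate k p M hpM (sec p M hpM) (sec_smul p M hpM) γ g c hc,
    sum_symbol_transferFamily_eq_zero k p M hpM (sec p M hpM) (sec_smul p M hpM) γ hpow g c hc, map_zero]

end Telescope

/-! ### Parabolic and elliptic generators of the dictionary kernel -/

section Generators

variable (k : Type) [CommRing k] (p M : ℕ) [Fact p.Prime] (hpM : Nat.Coprime p M) [NeZero M] [NeZero (p ^ 2 * M)]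
  [Fintype (diagTorus (ZMod p))] [Invertible (Fintype.card (diagTorus (ZMod p)) : k)]

omit [NeZero M] [Invertible (Fintype.card (diagTorus (ZMod p)) : k)] in
/-- The power hypothesis holds for `γ̃` with `δ⁻¹γ̃δ` PARABOLIC (powers and conjugates of parabolics are parabolic, and
parabolic symbols vanish). [cite: Knapp1993, (11.36); Shimura1971, §1.3] -/
theorem powHyp_of_isParabolic (γ : torusLevel p M)
    (hγ : (((torusLevelEquiv p M hpM γ : Gamma0 (p ^ 2 * M)) : SL(2, ℤ)) : Matrix (Fin 2) (Fin 2) ℤ).IsParabolic)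
    (x : torusLevel p M) (s₀ : Gamma0 M) (hx : (x : Gamma0 M) = s₀⁻¹ * γ.1 ^ Fintype.card (diagTorus (ZMod p)) * s₀) :
    Literature.NumberTheory.ModularSymbols.symbol (p ^ 2 * M) k (torusLevelEquiv p M hpM x : Gamma0 (p ^ 2 * M)) = 0 := by
  have hγ' : ((γ.1 : SL(2, ℤ)) : Matrix (Fin 2) (Fin 2) ℤ).IsParabolic := (isParabolic_torusLevelEquiv_iff p M hpM γ).1 hγ
  have hn : Fintype.card (diagTorus (ZMod p)) ≠ 0 := Fintype.card_ne_zero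
  have hxpar : (((torusLevelEquiv p M hpM x : Gamma0 (p ^ 2 * M)) : SL(2, ℤ)) : Matrix (Fin 2) (Fin 2) ℤ).IsParabolic := by
    rw [isParabolic_torusLevelEquiv_iff, hx, Subgroup.coe_mul, Subgroup.coe_mul, Subgroup.coe_inv, Subgroup.coe_pow]
    exact (isParabolic_conj_sl _ _).2 (isParabolic_pow hγ' hn)
  rw [Literature.NumberTheory.ModularSymbols.symbol_def]
  have h0 : symbolInt (p ^ 2 * M) (torusLevelEquiv p M hpM x : Gamma0 (p ^ 2 * M)) = 0 :=
    Subtype.ext (by rw [coe_symbolInt, periodFunctional_eq_zero_of_isParabolic hxpar]; rfl)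
  rw [h0, TensorProduct.tmul_zero]

/-- An ELLIPTIC element of `SL(2, ℤ)` satisfies `x¹² = 1` (`x² = −1` or `x³ = ∓1`). [cite: Knapp1993, (11.36)] -/
theorem pow_twelve_eq_one_of_isElliptic {x : SL(2, ℤ)} (hx : (x : Matrix (Fin 2) (Fin 2) ℤ).IsElliptic) : x ^ 12 = 1 := by
  rcases trace_of_isElliptic hx with h | h | h
  · have h2 : x ^ 2 = -1 := by rw [pow_two, mul_self_eq_neg_one_of_trace_eq_zero h]
    rw [show (12 : ℕ) = 2 * 6 by norm_num, pow_mul, h2]; norm_num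
  · have h3 : x ^ 3 = -1 := by rw [pow_succ, pow_two, mul_mul_self_eq_neg_one_of_trace_eq_one h]
    rw [show (12 : ℕ) = 3 * 4 by norm_num, pow_mul, h3]; norm_num
  · have h3 : x ^ 3 = 1 := by rw [pow_succ, pow_two, mul_mul_self_eq_one_of_trace_eq_neg_one h]
    rw [show (12 : ℕ) = 3 * 4 by norm_num, pow_mul, h3, one_pow]

omit [NeZero M] [NeZero (p ^ 2 * M)] in
include hpM in
/-- Under `H₁(…)^{T̃} ≅ H₁(Γ_T, k) ≅ Γ_T^{ab} ⊗ k`, `cosetClass[γ̃ ⊗ aδ_{T̃}] ↦ γ̃ ⊗ a`. [cite: Brown1982, Ch. III §6 Prop. 6.2] -/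
theorem H1AddEquiv_torusInvariantsEquiv_cosetClass_baseCycle (γ : torusLevel p M) (a : k) :
    H1AddEquivOfIsTrivial _ (torusInvariantsEquiv k p M hpM (cosetClass k p M (baseCycle k p M γ a))) =
      Additive.ofMul (Abelianization.of γ) ⊗ₜ[ℤ] a := by
  rw [torusInvariantsEquiv_cosetClass_of_eq k p M hpM _ _ (componentMap_single_eq_baseCycle k p M γ a),
    H1AddEquivOfIsTrivial_single]

omit [NeZero M] [NeZero (p ^ 2 * M)] in
include hpM in
/-- `cosetClass ∘ baseCycle` is additive in `γ̃`: `cosetClass[γ̃₁γ̃₂ ⊗ aδ_{T̃}] = cosetClass[γ̃₁ ⊗ aδ_{T̃}] + cosetClass[γ̃₂ ⊗ aδ_{T̃}]`.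
[cite: Brown1982, Ch. II §3] -/
theorem cosetClass_baseCycle_mul (γ₁ γ₂ : torusLevel p M) (a : k) :
    cosetClass k p M (baseCycle k p M (γ₁ * γ₂) a) = cosetClass k p M (baseCycle k p M γ₁ a) + cosetClass k p M (baseCycle k p M γ₂ a) := by
  apply (torusInvariantsEquiv k p M hpM).injective
  apply (H1AddEquivOfIsTrivial (Rep.trivial k (torusLevel p M) k)).injective
  rw [map_add, map_add, H1AddEquiv_torusInvariantsEquiv_cosetClass_baseCycle,
    H1AddEquiv_torusInvariantsEquiv_cosetClass_baseCycle, H1AddEquiv_torusInvariantsEquiv_cosetClass_baseCycle, map_mul, ofMul_mul,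
    TensorProduct.add_tmul]

omit [NeZero M] [NeZero (p ^ 2 * M)] in
include hpM in
/-- `cosetClass[γ̃ⁿ ⊗ aδ_{T̃}] = n · cosetClass[γ̃ ⊗ aδ_{T̃}]`. [cite: Brown1982, Ch. II §3] -/
theorem cosetClass_baseCycle_pow (γ : torusLevel p M) (a : k) (n : ℕ) :
    cosetClass k p M (baseCycle k p M (γ ^ n) a) = n • cosetClass k p M (baseCycle k p M γ a) := by
  apply (torusInvariantsEquiv k p M hpM).injective
  apply (H1AddEquivOfIsTrivial (Rep.trivial k (torusLevel p M) k)).injective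
  rw [map_nsmul, map_nsmul, H1AddEquiv_torusInvariantsEquiv_cosetClass_baseCycle,
    H1AddEquiv_torusInvariantsEquiv_cosetClass_baseCycle, map_pow, ofMul_pow, TensorProduct.smul_tmul']

omit [NeZero M] [NeZero (p ^ 2 * M)] in
/-- For `γ̃` with `δ⁻¹γ̃δ` ELLIPTIC and `12 ∈ kˣ`: `cosetClass[γ̃ ⊗ aδ_{T̃}] = 0` (a `12`-torsion class). [cite: Knapp1993, (11.36)] -/
theorem cosetClass_baseCycle_eq_zero_of_isElliptic [Invertible (12 : k)] (γ : torusLevel p M)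
    (hγ : (((torusLevelEquiv p M hpM γ : Gamma0 (p ^ 2 * M)) : SL(2, ℤ)) : Matrix (Fin 2) (Fin 2) ℤ).IsElliptic) (a : k) :
    cosetClass k p M (baseCycle k p M γ a) = 0 := by
  have h12 : γ ^ 12 = 1 := by
    apply (torusLevelEquiv p M hpM).injective
    rw [map_pow, map_one]
    exact Subtype.ext (pow_twelve_eq_one_of_isElliptic hγ)
  have h0 : cosetClass k p M (baseCycle k p M (1 : torusLevel p M) a) = 0 := by
    rw [← pow_zero γ, cosetClass_baseCycle_pow k p M hpM γ a 0, zero_smul]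
  have h := cosetClass_baseCycle_pow k p M hpM γ a 12
  rw [h12, h0] at h
  have h' : (12 : k) • cosetClass k p M (baseCycle k p M γ a) = 0 := by
    rw [show (12 : k) = ((12 : ℕ) : k) by norm_num, Nat.cast_smul_eq_nsmul]
    exact h.symm
  have h'' := congrArg (fun v => ⅟(12 : k) • v) h'
  simp only [smul_smul, invOf_mul_self, one_smul, smul_zero] at h''
  exact h''

/-- **`Π_f` and `Π_f ∘ M_θ` kill `cosetClass[γ̃ ⊗ aδ_{T̃}]` whenever `δ⁻¹γ̃δ` is parabolic or elliptic** (`12 ∈ kˣ`).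
[cite: AshStevens1986, §1 (1.3); Knapp1993, (11.36)] -/
theorem spreadPeriod_cosetClass_baseCycle_eq_zero [Invertible (12 : k)] (f : CuspForm (Gamma0 (p ^ 2 * M)) 2)
    (θ : (ZMod p)ˣ →* kˣ) (γ : torusLevel p M)
    (hγ : (((torusLevelEquiv p M hpM γ : Gamma0 (p ^ 2 * M)) : SL(2, ℤ)) : Matrix (Fin 2) (Fin 2) ℤ).IsParabolic ∨
      (((torusLevelEquiv p M hpM γ : Gamma0 (p ^ 2 * M)) : SL(2, ℤ)) : Matrix (Fin 2) (Fin 2) ℤ).IsElliptic) (a : k) :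
    spreadPeriod k p M hpM f (cosetClass k p M (baseCycle k p M γ a) : H1carrier k p M) = 0 ∧
      spreadPeriod k p M hpM f (H1coeffTwist k p M θ (cosetClass k p M (baseCycle k p M γ a) : H1carrier k p M)) = 0 := by
  rcases hγ with hpar | hell
  · have hpow := powHyp_of_isParabolic k p M hpM γ hpar
    have h1 := spreadPeriod_weightedBaseClass_eq_zero k p M hpM f γ hpow (fun _ => a) (fun _ => rfl)
    have h2 := spreadPeriod_weightedBaseClass_eq_zero k p M hpM f γ hpow
      (fun t => detChar k p θ ((1 : GL (Fin 2) (ZMod p)) * t) * a) (twistWeight_invariant k p M θ γ a)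
    rw [weightedBaseClass_const, map_smul] at h1
    rw [weightedBaseClass_twist, map_smul] at h2
    have e : ∀ {v : GL (Fin 2) (ZMod p) → k ⊗[ℤ] (periodLattice f).toIntSubmodule},
        (Fintype.card (diagTorus (ZMod p)) : k) • v = 0 → v = 0 := fun {v} hv => by
      have := congrArg (fun w => ⅟(Fintype.card (diagTorus (ZMod p)) : k) • w) hv
      simpa [smul_smul, invOf_mul_self] using this
    exact ⟨e h1, e h2⟩
  · rw [cosetClass_baseCycle_eq_zero_of_isElliptic k p M hpM γ hell a, Submodule.coe_zero, map_zero, map_zero, map_zero]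
    exact ⟨rfl, rfl⟩

end Generators

/-! ### The kernel of the dictionary (Knapp) and the spread-kernel hypotheses -/

section Kernel

variable (k : Type) [CommRing k] (p M : ℕ) [Fact p.Prime] (hpM : Nat.Coprime p M) [NeZero M] [NeZero (p ^ 2 * M)]
  [Fintype (diagTorus (ZMod p))] [Invertible (Fintype.card (diagTorus (ZMod p)) : k)] [Invertible (12 : k)]

omit [NeZero M] [NeZero (p ^ 2 * M)] [Invertible (12 : k)] in
/-- The inverse dictionary of a parabolic/elliptic class `[π ⊗ 1] ∈ H₁(Γ₀(p²M), k)` is `cosetClass[δπδ⁻¹ ⊗ δ_{T̃}]`.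
[cite: Brown1982, Ch. III §6 Prop. 6.2] -/
theorem torusInvariantsEquivGamma0_symm_epClass (π : Gamma0 (p ^ 2 * M)) :
    (torusInvariantsEquivGamma0 k p M hpM).symm (epClass (p ^ 2 * M) k π) =
      cosetClass k p M (baseCycle k p M ((torusLevelEquiv p M hpM).symm π) 1) := by
  rw [LinearEquiv.symm_apply_eq, torusInvariantsEquivGamma0, LinearEquiv.trans_apply,
    ← torusInvariantsEquiv_symm_single p M hpM k, LinearEquiv.apply_symm_apply, Iso.toLinearEquiv_apply,
    torusLevelH1Iso_single, MulEquiv.apply_symm_apply]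
  rfl

/-- **The spread period map kills the kernel of the dictionary** (Knapp's presentation; `12 ∈ kˣ`): for `z ∈ H₁(…)^{T̃}` with
`torusInvariantsToCuspidal z = 0`, both `Π_f z = 0` and `Π_f(M_θ z) = 0`. [cite: Knapp1993, Prop. 11.22 and (11.36)–(11.37); AshStevens1986, §1 (1.3)] -/
theorem spreadPeriod_eq_zero_of_cuspidal_eq_zero (H : periodFunctional_ker_le_ellipticParabolic_sup_commutator)
    (f : CuspForm (Gamma0 (p ^ 2 * M)) 2) (θ : (ZMod p)ˣ →* kˣ)
    (z : PermutationCoeff.H1Invariants k (redGL p M) (diagTorus (ZMod p))) (hz : torusInvariantsToCuspidal k p M hpM z = 0) :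
    spreadPeriod k p M hpM f (z : H1carrier k p M) = 0 ∧
      spreadPeriod k p M hpM f (H1coeffTwist k p M θ (z : H1carrier k p M)) = 0 := by
  have hw : cuspidalClassMap (p ^ 2 * M) k (torusInvariantsEquivGamma0 k p M hpM z) = 0 := hz
  have hmem := ker_cuspidalClassMap_le_epSpan (p ^ 2 * M) k H hw
  have hz' : z = (torusInvariantsEquivGamma0 k p M hpM).symm (torusInvariantsEquivGamma0 k p M hpM z) :=
    (LinearEquiv.symm_apply_apply _ _).symm
  rw [hz']
  generalize torusInvariantsEquivGamma0 k p M hpM z = w at hmem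
  induction hmem using Submodule.span_induction with
  | mem x hx =>
    obtain ⟨π, hπ, rfl⟩ := hx
    rw [torusInvariantsEquivGamma0_symm_epClass]
    refine spreadPeriod_cosetClass_baseCycle_eq_zero k p M hpM f θ _ ?_ 1
    rwa [MulEquiv.apply_symm_apply]
  | zero => simp
  | add x y _ _ hx hy =>
    rw [map_add, Submodule.coe_add, map_add, hx.1, hy.1, map_add, map_add, hx.2, hy.2, add_zero]
    exact ⟨rfl, rfl⟩
  | smul c x _ hx =>
    rw [map_smul, Submodule.coe_smul, map_smul, hx.1, map_smul, map_smul, hx.2, smul_zero]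
    exact ⟨rfl, rfl⟩

/-- **`TwistedSpreadKernelHyp` holds**, granted Knapp's presentation and `12 ∈ kˣ` (hypothesis (H2) of
`Summit.…CarrierDatum.not_caseOne_of_carrier`). [cite: Knapp1993, Prop. 11.22; AshStevens1986, §1 (1.3)] -/
theorem twistedSpreadKernelHyp_of_knapp (H : periodFunctional_ker_le_ellipticParabolic_sup_commutator)
    (f : CuspForm (Gamma0 (p ^ 2 * M)) 2) (θ : (ZMod p)ˣ →* kˣ) : TwistedSpreadKernelHyp k p M hpM f θ :=
  fun z hz => (spreadPeriod_eq_zero_of_cuspidal_eq_zero k p M hpM H f θ z hz).2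

/-- **Multiplicity-one hypothesis** for `f` in the operator-free form the K-line needs: an invariant class with zero `f`-period
class differs from a class in the kernel of the dictionary by one all of whose torus translates have zero `f`-period class
(for a newform `f` of level `p²M` this is Atkin–Lehner multiplicity one: the translates `e_{T̃}(g·)` are Hecke-equivariant
endomorphisms at `p`, which preserve the `f`-isotypic kernel).  A hypothesis, not a theorem of this file.
[cite: AshStevens1986, §1 (1.3)] -/
def MultOneHyp (f : CuspForm (Gamma0 (p ^ 2 * M)) 2) : Prop :=
  ∀ z : PermutationCoeff.H1Invariants k (redGL p M) (diagTorus (ZMod p)), torusPeriodClass k p M hpM f z = 0 →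
    ∃ z₀ : PermutationCoeff.H1Invariants k (redGL p M) (diagTorus (ZMod p)), torusInvariantsToCuspidal k p M hpM z₀ = 0 ∧
      ∀ g : GL (Fin 2) (ZMod p), torusPeriodClass k p M hpM f
        (PermutationCoeff.toInvariants (redGL p M) (diagTorus (ZMod p)) (H1carrierRep k p M g ((z : H1carrier k p M) - z₀))) = 0

/-- **`SpreadKernelHyp` follows from Knapp's presentation and multiplicity one** (hypothesis (H1) of
`Summit.…CarrierDatum.not_caseOne_of_carrier`, reduced to `MultOneHyp`). [cite: Knapp1993, Prop. 11.22; AshStevens1986, §1 (1.3)] -/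
theorem spreadKernelHyp_of_knapp_of_multOne (H : periodFunctional_ker_le_ellipticParabolic_sup_commutator)
    (f : CuspForm (Gamma0 (p ^ 2 * M)) 2) (hM1 : MultOneHyp k p M hpM f) : SpreadKernelHyp k p M hpM f := by
  intro z hz
  obtain ⟨z₀, hz₀, hg⟩ := hM1 z hz
  have h0 := (spreadPeriod_eq_zero_of_cuspidal_eq_zero k p M hpM H f 1 z₀ hz₀).1
  have e : (z : H1carrier k p M) = ((z : H1carrier k p M) - z₀) + z₀ := (sub_add_cancel _ _).symm
  rw [e, map_add, h0, add_zero]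
  funext g
  rw [spreadPeriod, PermutationCoeff.spread_apply, Pi.zero_apply]
  exact hg g

end Kernel

end FullLevel

end Literature.NumberTheory.ModularSymbols
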